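import Literature.Computability.AlgebraicComplexity.FSV18SparseShift
import Literature.Computability.AlgebraicComplexity.FSV18SuccinctGenerators
import HarnessLib

/-!
# The shifted succinct Shpilka–Volkovich generator hits sparse polynomials — discharges of
# `ForbesShpilkaVolk2018_svGeneratorHitsSparse` (FSV Cor. 34), `FSV2018_lemma31`, `FSV2018_lemma32`,
# `FSV2018_thm9_sparse` (Forbes–Shpilka–Volk 2018, §5.1)

Sibling proofs file of `SuccinctSVGenerator.lean` (the named fact
`ForbesShpilkaVolk2018_svGeneratorHitsSparse`, FSV Cor. 34 in generator form) and of
`FSV18SuccinctGenerators.lean` (the named facts `FSV2018_lemma31`, `FSV2018_lemma32` and the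
conditional `FSV2018_thm9_sparse_of_svGeneratorHitsSparse`). With FSV Lemma 32 over any integral
domain from `FSV18SparseShift.lean` (`SparseShift.exists_narrow_monomial`), what remains is the
planting argument of FSV Lemmas 28/31 for the tree's concrete generator
`svGenCoeff n k m = ∑_{j<k} y_j ∏_{i ∈ supp m} z_{j,i} ∏_{i ∉ supp m} (1 - z_{j,i}) + 1`:

* `plantSubst` — the seed substitution of the printed proof ("`z_j = 𝟙_{S_j}`"): given a partial
  assignment `P : Fin k → Option ι` of seed blocks to coefficient coordinates (`ι` = multilinear
  monomials), block `j ↦ some t` gets `y_j := c_t` (the coordinate variable itself) and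
  `z_{j,i} := [t_i ≠ 0]`; unassigned blocks get `y_j := 0`.
* `aeval_plantSubst_svGenCoeff` — under it the generator coordinate at `m` becomes
  `(if m is planted then c_m else 0) + 1` (FSV Lemma 28: "`|T|` distinct `y` variables are planted
  in the coordinates corresponding to `T`, while the rest of the entries are zeroed out", plus the
  shift `+ 𝟙` of Construction 29).
* `bind₁_svGenCoeff_ne_zero_of_narrow` — FSV Lemma 31: if `D(X + 𝟙)` has a monomial `m₀` with
  `|supp m₀| ≤ k` then `D ∘ G^{SV'}_{n,k} ≢ 0`: plant the `≤ k` coordinates of `supp m₀`; the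
  composite is `D(X + 𝟙)` with the variables outside `supp m₀` killed, which keeps the coefficient
  of `m₀` (`SparseShift.coeff_subst_self`).
* Discharges: `FSV2018_lemma31_holds`, `FSV2018_lemma32_holds` (from
  `SparseShift.exists_narrow_monomial_log`), `ForbesShpilkaVolk2018_svGeneratorHitsSparse_holds`
  (Lemma 31 + Lemma 32 with the all-ones shift: `|supp D| ≤ 2^k` gives `|supp m₀| ≤ k`), and
  `FSV2018_thm9_sparse_holds` (via t18's `FSV2018_thm9_sparse_of_svGeneratorHitsSparse`).

## References
* [ForbesShpilkaVolk2018] Theory Comput. 14 (2018), arXiv:1701.05328: Constructions 25/29,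
  Lemmas 28, 31, 32, 33, Cor. 34, Thm. 9 (§5.1).
-/

noncomputable section

namespace Literature.Computability.AlgebraicComplexity

open MvPolynomial

/-! ### Planting seed variables (FSV Lemma 28 for the tree's `svGenCoeff`) -/

section Planting

variable {F : Type*} [Field F] {n k : ℕ}

/-- **The planting substitution** of FSV Lemma 28's proof, for a partial assignment `P` of the `k`
seed blocks to coordinates (multilinear monomials): block `j ↦ some t` gets `y_j := c_t` and
`z_{j,i} := [t_i ≠ 0]` (the indicator vector of `supp t`), an unassigned block gets `y_j := 0`
(and `z_{j,i} := 0`). [cite: ForbesShpilkaVolk2018, Lemma 28 (proof: z_j = 𝟙_{S_j})] -/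
def plantSubst (P : Fin k → Option (multilinearMonomials n)) :
    Fin k ⊕ (Fin k × Fin n) → MvPolynomial (multilinearMonomials n) F :=
  Sum.elim (fun j => (P j).elim 0 fun t => X t)
    (fun p => (P p.1).elim 0 fun t => if (t : Fin n →₀ ℕ) p.2 = 0 then 0 else 1)

omit [Field F] in
/-- Two multilinear exponent vectors with the same zero pattern are equal. [cite: ForbesShpilkaVolk2018, Lemma 28 (proof)] -/
theorem multilinear_eq_of_zero_iff {m t : multilinearMonomials n}
    (h : ∀ i, (m : Fin n →₀ ℕ) i = 0 ↔ (t : Fin n →₀ ℕ) i = 0) : m = t := by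
  apply Subtype.ext
  ext i
  have hm := m.2 i
  have ht := t.2 i
  have hi := h i
  omega

/-- One factor of the generator under the planting substitution of an assigned block: the factor
at variable `i` of coordinate `m`, with `z_{j,i} := [t_i ≠ 0]`, is `[m_i = 0 ↔ t_i = 0]`.
[cite: ForbesShpilkaVolk2018, Lemma 28 (proof)] -/
theorem aeval_plantSubst_factor (P : Fin k → Option (multilinearMonomials n)) {j : Fin k}
    {t : multilinearMonomials n} (hj : P j = some t) (m : multilinearMonomials n) (i : Fin n) :
    aeval (plantSubst (F := F) P)
        ((if (m : Fin n →₀ ℕ) i = 0 then 1 - X (Sum.inr (j, i)) else X (Sum.inr (j, i))) :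
          MvPolynomial (Fin k ⊕ (Fin k × Fin n)) F) =
      if ((m : Fin n →₀ ℕ) i = 0 ↔ (t : Fin n →₀ ℕ) i = 0) then 1 else 0 := by
  have hz : plantSubst (F := F) P (Sum.inr (j, i)) =
      if (t : Fin n →₀ ℕ) i = 0 then 0 else 1 := by
    simp [plantSubst, hj]
  by_cases hm : (m : Fin n →₀ ℕ) i = 0 <;> by_cases ht : (t : Fin n →₀ ℕ) i = 0 <;>
    simp [hm, ht, hz, map_sub]

/-- One block of the generator under the planting substitution: an assigned block `j ↦ t`
contributes `c_t · [m = t]`, an unassigned block contributes `0`.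
[cite: ForbesShpilkaVolk2018, Lemma 28] -/
theorem aeval_plantSubst_block (P : Fin k → Option (multilinearMonomials n)) (j : Fin k)
    (m : multilinearMonomials n) :
    aeval (plantSubst (F := F) P)
        ((X (Sum.inl j) * ∏ i : Fin n,
          (if (m : Fin n →₀ ℕ) i = 0 then 1 - X (Sum.inr (j, i)) else X (Sum.inr (j, i)))) :
          MvPolynomial (Fin k ⊕ (Fin k × Fin n)) F) =
      (P j).elim 0 fun t => if m = t then X t else 0 := by
  classical
  cases hj : P j with
  | none =>
    rw [map_mul, aeval_X]
    simp [plantSubst, hj]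
  | some t =>
    rw [map_mul, aeval_X, map_prod]
    have hy : plantSubst (F := F) P (Sum.inl j) = X t := by simp [plantSubst, hj]
    rw [hy, Finset.prod_congr rfl fun i _ => aeval_plantSubst_factor P hj m i,
      Fintype.prod_boole]
    simp only [Option.elim_some]
    by_cases hmt : m = t
    · subst hmt; simp
    · have hne : ¬ ∀ i, ((m : Fin n →₀ ℕ) i = 0 ↔ (t : Fin n →₀ ℕ) i = 0) :=
        fun h => hmt (multilinear_eq_of_zero_iff h)
      simp [hne, hmt]

/-- **FSV Lemma 28 for `svGenCoeff`, under the shift of Construction 29.** If `P` assigns seed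
blocks injectively and its image is `T`, then under the planting substitution the generator
coordinate at `m` is `(if m ∈ T then c_m else 0) + 1` ("`|T|` distinct `y` variables are planted in
the coordinates corresponding to `T`, while the rest of the entries are zeroed out", then `+ 𝟙`).
[cite: ForbesShpilkaVolk2018, Lemma 28 and Construction 29] -/
theorem aeval_plantSubst_svGenCoeff (P : Fin k → Option (multilinearMonomials n))
    (hinj : ∀ j j' t, P j = some t → P j' = some t → j = j')
    (T : Finset (multilinearMonomials n)) (hT : ∀ t, t ∈ T ↔ ∃ j, P j = some t)
    (m : multilinearMonomials n) :
    aeval (plantSubst (F := F) P) (svGenCoeff F n k (m : Fin n →₀ ℕ)) =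
      (if m ∈ T then X m else 0) + 1 := by
  classical
  rw [svGenCoeff, map_add, map_one, map_sum]
  congr 1
  rw [Finset.sum_congr rfl fun j _ => aeval_plantSubst_block P j m]
  by_cases hm : m ∈ T
  · obtain ⟨j₀, hj₀⟩ := (hT m).1 hm
    rw [if_pos hm, Finset.sum_eq_single j₀]
    · simp [hj₀]
    · intro j _ hne
      cases hj : P j with
      | none => simp
      | some t =>
        simp only [Option.elim_some]
        rw [if_neg]
        rintro rfl
        exact hne (hinj j j₀ m hj hj₀)
    · intro h; exact absurd (Finset.mem_univ j₀) h
  · rw [if_neg hm]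
    refine Finset.sum_eq_zero fun j _ => ?_
    cases hj : P j with
    | none => simp
    | some t =>
      simp only [Option.elim_some]
      rw [if_neg]
      rintro rfl
      exact hm ((hT m).2 ⟨j, hj⟩)

/-- The planting assignment for a set `T` of at most `k` coordinates: the first `|T|` blocks are
assigned to the members of `T` (in the order of `T.equivFin`), the others are switched off.
[cite: ForbesShpilkaVolk2018, Lemma 28 (proof)] -/
def plantOf (T : Finset (multilinearMonomials n)) (j : Fin k) : Option (multilinearMonomials n) :=
  if h : (j : ℕ) < T.card then some ((T.equivFin.symm ⟨j, h⟩ : T) : multilinearMonomials n)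
  else none

omit [Field F] in
/-- `plantOf T` is injective on assigned blocks. [cite: ForbesShpilkaVolk2018, Lemma 28 (proof)] -/
theorem plantOf_inj (T : Finset (multilinearMonomials n)) (j j' : Fin k)
    (t : multilinearMonomials n) (hj : plantOf (k := k) T j = some t)
    (hj' : plantOf (k := k) T j' = some t) : j = j' := by
  unfold plantOf at hj hj'
  split_ifs at hj hj' with h h'
  simp only [Option.some.injEq] at hj hj'
  have := T.equivFin.symm.injective (Subtype.ext (hj.trans hj'.symm))
  apply Fin.ext
  simpa using congrArg Fin.val this

omit [Field F] in
/-- `plantOf T` assigns exactly the members of `T` when `|T| ≤ k`.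
[cite: ForbesShpilkaVolk2018, Lemma 28 (proof)] -/
theorem mem_iff_exists_plantOf (T : Finset (multilinearMonomials n)) (hTk : T.card ≤ k)
    (t : multilinearMonomials n) : t ∈ T ↔ ∃ j : Fin k, plantOf T j = some t := by
  constructor
  · intro ht
    refine ⟨⟨(T.equivFin ⟨t, ht⟩ : ℕ), lt_of_lt_of_le (T.equivFin ⟨t, ht⟩).2 hTk⟩, ?_⟩
    simp [plantOf]
  · rintro ⟨j, hj⟩
    unfold plantOf at hj
    split_ifs at hj with h
    simp only [Option.some.injEq] at hj
    rw [← hj]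
    exact (T.equivFin.symm ⟨j, h⟩).2

/-- **FSV Lemma 31 (for the tree's shifted generator).** If the shift `D(X + 𝟙)` of `D` has a
monomial `m₀` involving at most `k` coordinates, then `D ∘ G^{SV'}_{n,k}` (substitute
`svGenCoeff n k m` for `c_m`) is a nonzero polynomial in the seed variables: under the planting
substitution for `T = supp m₀` it becomes `D(X + 𝟙)` with the variables outside `T` killed, which
retains the coefficient of `m₀`. [cite: ForbesShpilkaVolk2018, Lemma 31] -/
theorem bind₁_svGenCoeff_ne_zero_of_narrow {D : MvPolynomial (multilinearMonomials n) F}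
    {m₀ : multilinearMonomials n →₀ ℕ}
    (hm₀ : m₀ ∈ (aeval (fun v : multilinearMonomials n =>
      (X v + 1 : MvPolynomial (multilinearMonomials n) F)) D).support)
    (hk : m₀.support.card ≤ k) :
    bind₁ (fun m : multilinearMonomials n => svGenCoeff F n k (m : Fin n →₀ ℕ)) D ≠ 0 := by
  classical
  set T := m₀.support with hTdef
  -- killing the variables outside `T` keeps the coefficient of `m₀`
  have hE : aeval (fun v : multilinearMonomials n =>
      if v ∈ T then (X v : MvPolynomial (multilinearMonomials n) F) else 0)
        (aeval (fun v : multilinearMonomials n =>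
          (X v + 1 : MvPolynomial (multilinearMonomials n) F)) D) ≠ 0 := by
    intro h0
    have h := SparseShift.coeff_subst_self T
      (aeval (fun v : multilinearMonomials n =>
        (X v + 1 : MvPolynomial (multilinearMonomials n) F)) D) (subset_refl T)
    rw [h0, coeff_zero] at h
    exact (mem_support_iff.mp hm₀) h.symm
  -- the composite substitution is `c_v ↦ (if v ∈ T then c_v else 0) + 1`
  have hcomp : aeval (fun v : multilinearMonomials n =>
      if v ∈ T then (X v : MvPolynomial (multilinearMonomials n) F) else 0)
        (aeval (fun v : multilinearMonomials n =>
          (X v + 1 : MvPolynomial (multilinearMonomials n) F)) D) =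
      aeval (fun v : multilinearMonomials n =>
        (if v ∈ T then (X v : MvPolynomial (multilinearMonomials n) F) else 0) + 1) D := by
    rw [← AlgHom.comp_apply, comp_aeval]
    exact congrArg (fun g => aeval g D) (funext fun v => by rw [map_add, map_one, aeval_X])
  -- under the planting substitution for `T`, `D ∘ G^{SV'}` becomes that composite
  have key : aeval (plantSubst (F := F) (plantOf (k := k) T))
      (bind₁ (fun m : multilinearMonomials n => svGenCoeff F n k (m : Fin n →₀ ℕ)) D) =
      aeval (fun v : multilinearMonomials n =>
        (if v ∈ T then (X v : MvPolynomial (multilinearMonomials n) F) else 0) + 1) D := by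
    rw [aeval_bind₁]
    exact congrArg (fun g => aeval g D) (funext fun m =>
      aeval_plantSubst_svGenCoeff (F := F) (plantOf T) (plantOf_inj T) T
        (mem_iff_exists_plantOf T hk) m)
  intro h0
  apply hE
  rw [hcomp, ← key, h0, map_zero]

end Planting

/-! ### Discharges -/

section Discharges

/-- **Discharge of `FSV2018_lemma32`** (FSV Lemma 32 = ToC Lemma 5.8 [Forbes 2015; GKST 2016]):
a nonzero polynomial with at most `s` monomials, shifted by a full-support vector, has a monomial
of support at most `log s` — `SparseShift.exists_narrow_monomial_log` (any field, any variables).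
[cite: ForbesShpilkaVolk2018, Lemma 32] -/
theorem FSV2018_lemma32_holds : FSV2018_lemma32 := by
  intro F _ ι P s hP hs α hα
  classical
  have hfun : (fun i => (X i + C (α i) : MvPolynomial ι F)) = fun i => C (α i) + X i :=
    funext fun i => add_comm _ _
  rw [hfun]
  exact SparseShift.exists_narrow_monomial_log α hα hP hs

/-- **Discharge of `ForbesShpilkaVolk2018_svGeneratorHitsSparse` (FSV Cor. 34, generator form, any
field):** a nonzero `D` in the `2ⁿ` coefficient variables with at most `2^k` monomials is not
annihilated by `G^{SV'}_{n,k}` — FSV Lemma 32 with the all-ones shift gives a monomial of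
`D(X + 𝟙)` with `2^{|supp|} ≤ |supp D| ≤ 2^k` variables, i.e. at most `k`, and FSV Lemma 31 plants
them. [cite: ForbesShpilkaVolk2018, Cor. 34] -/
theorem ForbesShpilkaVolk2018_svGeneratorHitsSparse_holds :
    ∀ (F : Type*) [Field F], ForbesShpilkaVolk2018_svGeneratorHitsSparse F := by
  intro F _ n k D hD hs
  classical
  obtain ⟨m₀, hm₀, hle⟩ := SparseShift.exists_narrow_monomial
    (fun _ : multilinearMonomials n => (1 : F)) (fun _ => one_ne_zero) hD
  have hk : m₀.support.card ≤ k := by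
    by_contra h
    have h' : 2 ^ k < 2 ^ m₀.support.card := Nat.pow_lt_pow_right (by norm_num) (by omega)
    omega
  have hshift : aeval (fun v : multilinearMonomials n =>
      (C 1 + X v : MvPolynomial (multilinearMonomials n) F)) D =
      aeval (fun v : multilinearMonomials n =>
        (X v + 1 : MvPolynomial (multilinearMonomials n) F)) D := by
    exact congrArg (fun g => aeval g D) (funext fun v => by rw [map_one, add_comm])
  rw [hshift] at hm₀
  exact bind₁_svGenCoeff_ne_zero_of_narrow hm₀ hk

/-- **Discharge of `FSV2018_thm9_sparse`** (FSV Thm. 9, bullet "sparse polynomials", in the frame of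
`FSV18SuccinctGenerators.lean`): via `FSV2018_thm9_sparse_of_svGeneratorHitsSparse` and the
discharge of Cor. 34 above. [cite: ForbesShpilkaVolk2018, Thm. 9 and Cor. 34] -/
theorem FSV2018_thm9_sparse_holds : FSV2018_thm9_sparse :=
  FSV2018_thm9_sparse_of_svGeneratorHitsSparse fun F _ =>
    ForbesShpilkaVolk2018_svGeneratorHitsSparse_holds F

end Discharges

end Literature.Computability.AlgebraicComplexity
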